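/-
Origin: expansion seat `planner-pub-hodgecm-pv14-g6-0`, handover import Pv14g6.SchwartzLinearFlowDeriv -> import HodgeCM.Automorphic.SchwartzLinearFlowDeriv ; after SchwartzLinearFlowDeriv (this seat t31 row 1, same run); independent of row 2 (`HOME/pub-hodgecm-pv14-g6/lean/Pv14g6/SchwartzInverseFlowDeriv.lean`, md5 69ac83ec, 113 lines);
landed by the gen-8 packager in gate run 31 as `HodgeCM/Automorphic/SchwartzInverseFlowDeriv.lean` (import ^import Pv14g6\.SchwartzLinearFlowDeriv[ \t]*$→import HodgeCM.Automorphic.SchwartzLinearFlowDeriv ×1).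
-/
/-
Copyright: HodgeCM public adjudication package, seat pub-hodgecm-pv14-g6 (DAG-NODE PROVER #14, gen 6).
File #18 of this seat.  Kernel-checked, no new axioms.  Imports file #16 of this seat
(`SchwartzLinearFlowDeriv`) and Mathlib only.
-/
import Summits.HodgeConjecture.HodgeCM.Automorphic.SchwartzLinearFlowDeriv_2

/-!
# One-parameter groups acting on Schwartz space through inverses

Levi-type actions are by `Φ ↦ Φ ∘ a⁻¹` (`leviCLM V A = compCLMOfContinuousLinearEquiv ℂ A.symm`,
definitionally, in `SchwartzWeilLevi`).  For a one-parameter GROUP `L : ℝ → (E ≃L[ℝ] E)`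
(`L 0 = 1`, `L (s + t) = L s ∘ L t`) differentiable at `0` with `L'(0) = A`:

* `coe_symm_eq_of_group` : `(L s)⁻¹ = L (-s)`;
* `hasDerivAt_coe_symm_of_group` : `s ↦ (L s)⁻¹` is differentiable at `0` with derivative `-A`
  (no completeness of `E` needed — the group law replaces the differentiability of inversion);
* `tendsto_compCLM_symm_sub_div` : `s⁻¹ • (Φ ∘ (L s)⁻¹ - Φ) → -(flowGen A Φ)` in `𝓢(E, F)`, and the
  base-point version `tendsto_compCLM_symm_sub_div_at`.

Only published mathematics is used (Mathlib); nothing here refers to the objects under adjudication.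
-/

noncomputable section

open Filter Topology
open scoped SchwartzMap

namespace HodgeCM
namespace SchwartzWeil

variable {E F : Type*} [NormedAddCommGroup E] [NormedSpace ℝ E] [NormedAddCommGroup F]
  [NormedSpace ℝ F]

section Group

variable {L : ℝ → (E ≃L[ℝ] E)} {A : E →L[ℝ] E}

/-- In a one-parameter group, `(L s)⁻¹ x = L (-s) x`. -/
theorem symm_apply_eq_of_group (hL0 : ((L 0 : E ≃L[ℝ] E) : E →L[ℝ] E) = 1)
    (hmul : ∀ s t x, L (s + t) x = L s (L t x)) (s : ℝ) (x : E) : (L s).symm x = L (-s) x := by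
  rw [ContinuousLinearEquiv.symm_apply_eq, ← hmul, add_neg_cancel]
  have h := congrArg (fun T : E →L[ℝ] E => T x) hL0
  simpa using h.symm

/-- In a one-parameter group, `(L s)⁻¹ = L (-s)` as continuous linear maps. -/
theorem coe_symm_eq_of_group (hL0 : ((L 0 : E ≃L[ℝ] E) : E →L[ℝ] E) = 1)
    (hmul : ∀ s t x, L (s + t) x = L s (L t x)) (s : ℝ) :
    (((L s).symm : E ≃L[ℝ] E) : E →L[ℝ] E) = ((L (-s) : E ≃L[ℝ] E) : E →L[ℝ] E) := by
  ext x
  simpa using symm_apply_eq_of_group hL0 hmul s x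

/-- (Ported verbatim from the HodgeCMPerL package; no docstring in the source.) -/
theorem coe_symm_zero_of_group (hL0 : ((L 0 : E ≃L[ℝ] E) : E →L[ℝ] E) = 1)
    (hmul : ∀ s t x, L (s + t) x = L s (L t x)) :
    (((L 0).symm : E ≃L[ℝ] E) : E →L[ℝ] E) = 1 := by
  rw [coe_symm_eq_of_group hL0 hmul, neg_zero, hL0]

/-- The inverse family of a differentiable one-parameter group is differentiable at `0` with
derivative `-A`. -/
theorem hasDerivAt_coe_symm_of_group (hL0 : ((L 0 : E ≃L[ℝ] E) : E →L[ℝ] E) = 1)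
    (hL : HasDerivAt (fun s => ((L s : E ≃L[ℝ] E) : E →L[ℝ] E)) A 0)
    (hmul : ∀ s t x, L (s + t) x = L s (L t x)) :
    HasDerivAt (fun s => (((L s).symm : E ≃L[ℝ] E) : E →L[ℝ] E)) (-A) 0 := by
  have hL' : HasDerivAt (fun s => ((L s : E ≃L[ℝ] E) : E →L[ℝ] E)) A (-0 : ℝ) := by
    rwa [neg_zero]
  have hneg := hL'.scomp (0 : ℝ) (hasDerivAt_neg (0 : ℝ))
  rw [neg_one_smul] at hneg
  refine hneg.congr_of_eventuallyEq (Eventually.of_forall fun s => ?_)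
  simpa only [Function.comp_apply] using coe_symm_eq_of_group hL0 hmul s

/-- The group law for the inverse family: `(L (s + t))⁻¹ x = (L s)⁻¹ ((L t)⁻¹ x)` requires
commutativity `L s ∘ L t = L t ∘ L s`, automatic in a one-parameter group. -/
theorem symm_add_apply_of_group (hL0 : ((L 0 : E ≃L[ℝ] E) : E →L[ℝ] E) = 1)
    (hmul : ∀ s t x, L (s + t) x = L s (L t x)) (s t : ℝ) (x : E) :
    (L (s + t)).symm x = (L s).symm ((L t).symm x) := by
  simp only [symm_apply_eq_of_group hL0 hmul, ← hmul]
  congr 1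
  ring

variable (𝕜 : Type*) [RCLike 𝕜] [NormedSpace 𝕜 F] [SMulCommClass ℝ 𝕜 F]

/-- **Action through inverses**: `s⁻¹ • (Φ ∘ (L s)⁻¹ - Φ) → -(flowGen A Φ)` in `𝓢(E, F)`. -/
theorem tendsto_compCLM_symm_sub_div (hL0 : ((L 0 : E ≃L[ℝ] E) : E →L[ℝ] E) = 1)
    (hL : HasDerivAt (fun s => ((L s : E ≃L[ℝ] E) : E →L[ℝ] E)) A 0)
    (hmul : ∀ s t x, L (s + t) x = L s (L t x)) (Φ : 𝓢(E, F)) :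
    Tendsto (fun s : ℝ => s⁻¹ • (SchwartzMap.compCLMOfContinuousLinearEquiv 𝕜 (L s).symm Φ - Φ))
      (𝓝[≠] 0) (𝓝 (-(flowGen A Φ))) := by
  have h := tendsto_compCLM_sub_div 𝕜 (L := fun s => (L s).symm) (coe_symm_zero_of_group hL0 hmul)
    (hasDerivAt_coe_symm_of_group hL0 hL hmul) Φ
  have hneg : flowGen (-A) Φ = -(flowGen A Φ) := by
    ext x
    simp [flowGen_apply]
  rwa [hneg] at h

/-- Base-point version of `tendsto_compCLM_symm_sub_div`. -/
theorem tendsto_compCLM_symm_sub_div_at (hL0 : ((L 0 : E ≃L[ℝ] E) : E →L[ℝ] E) = 1)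
    (hL : HasDerivAt (fun s => ((L s : E ≃L[ℝ] E) : E →L[ℝ] E)) A 0)
    (hmul : ∀ s t x, L (s + t) x = L s (L t x)) (Φ : 𝓢(E, F)) (s₀ : ℝ) :
    Tendsto (fun s : ℝ => s⁻¹ • (SchwartzMap.compCLMOfContinuousLinearEquiv 𝕜 (L (s₀ + s)).symm Φ
        - SchwartzMap.compCLMOfContinuousLinearEquiv 𝕜 (L s₀).symm Φ)) (𝓝[≠] 0)
      (𝓝 (-(flowGen A (SchwartzMap.compCLMOfContinuousLinearEquiv 𝕜 (L s₀).symm Φ)))) := by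
  have h := tendsto_compCLM_sub_div_at 𝕜 (L := fun s => (L s).symm) (coe_symm_zero_of_group hL0 hmul)
    (hasDerivAt_coe_symm_of_group hL0 hL hmul) (symm_add_apply_of_group hL0 hmul) Φ s₀
  have hneg : ∀ Ψ : 𝓢(E, F), flowGen (-A) Ψ = -(flowGen A Ψ) := by
    intro Ψ
    ext x
    simp [flowGen_apply]
  rwa [hneg] at h

end Group

end SchwartzWeil
end HodgeCM
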